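import Mathlib.Algebra.MvPolynomial.Basic
import Mathlib.Data.Nat.Log
import Mathlib.GroupTheory.Perm.Basic
import Mathlib.Data.Fintype.Perm
import Mathlib.Data.Fintype.Sum
import Mathlib.Data.Fintype.Prod
import Mathlib.Tactic.Linarith

/-!
# Crux `MonotoneCoverHard` (stmt-ValiantsHypothesis-7421), line `few-state-cut`: the bet holds for
GRADED covers (every known label-bijective cover) — balanced layer cut with at most `m²` states

Helper file for the line `Cruxes/MonotoneCoverHard/Lines/few_state_cut.lean` (val-width-7421-p2 g0,
2026-08-27).  The line's bet `stub_fewStateCut` (repaired registration of 2026-08-27: uniform threshold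
`n₀ ≤ n`) asks, for every label-bijective Pfaffian cover `(m, E, a)` of `per_n`, for a vertex set
`S ⊆ Fin m ⊕ Fin m` that is BALANCED (every weight-nonzero perfect matching `τ` has between `n/3` and
`2n/3` variable-labelled edges with both endpoints in `S`) and has quasi-polynomially few CROSSING STATES
`{(i, τ i) : exactly one endpoint in S}`.  The line card records that this holds "for every cover we know
(ABP split graphs: Grenet's `2^n − 1` cover, permutation decision trees — tight cuts = layers, `≤ m²`
states)".  This file makes that remark a kernel theorem, in the stub's own language and WITHOUT any
graph-theoretic definitions, for the class of GRADED covers: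

* a level function `g : Fin m ⊕ Fin m → ℕ` such that along every edge of `E` with nonzero label the
  level of the column endpoint equals the level of the row endpoint, plus one exactly when the label is
  a variable (`hvar`, `hone`);
* every weight-nonzero perfect matching has exactly one variable edge with row endpoint on each level
  `ℓ < n` and none higher (`hlev`, `hlt`);
* a weight-nonzero perfect matching is determined by its variable edges (`hinj`) — for a cover this is
  label-injectivity, a consequence of `per_n = PM_E(a)` (coefficients `≤ 1`).

Every cover obtained from an algebraic branching program / layered DAG `D` by vertex splitting (rows
`u^out`, columns `v^in`, DAG edges `(u^out, v^in)` with their labels, idle edges `(v^out, v^in)`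
labelled `1`) is graded: by the exchange property of `s–t` paths and label-bijectivity, every node `u`
is reached after a well-defined number `d(u)` of variable edges, and `g(u^out) = g(u^in) = d(u)` works.

Results (all unconditional, purely combinatorial; `R` any commutative semiring, any variable type `ι`):

* `inside_filter_eq_of_graded`, `card_var_below_eq_of_graded` — for the LAYER CUT
  `S_h = {inl i : g (inl i) < h} ∪ {inr j : g (inr j) ≤ h}` the inside-count of every weight-nonzero
  perfect matching is exactly `h` (`h ≤ n`);
* `crossing_filter_eq_of_graded` — its crossing set is the set of its NON-variable edges with row
  endpoint on level `h`;
* `crossing_eq_of_key_eq` — that set is determined by the pair (row endpoint of the level-`h` variable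
  edge, column endpoint of the level-`(h-1)` variable edge): two matchings with the same pair can be
  recombined (one inside level `h`, the other elsewhere) into a third weight-nonzero perfect matching with
  the same variable edges, which `hinj` identifies with the first;
* (sequel file `PolyaContinuedMonotoneCoverHardGradedCutExists.lean`)
  `exists_balanced_cut_card_le_sq_of_graded` — hence for `2 ≤ n` the layer cut at `h = ⌈n/2⌉` is
  balanced and has at most `m * m` states, and `exists_balanced_cut_of_graded` puts this in the exact
  shape of the stub's conclusion with exponent `c = 2` (`m * m ≤ 2^((log₂ m + 2)^2)`).

What this does NOT do: it says nothing about non-graded covers (perfect-matching families with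
simultaneously flippable alternating cycles), which is where the bet `stub_fewStateCut` lives; and it
does not move VP ≠ VNP.  No definitions are introduced.
-/

namespace Summit.ValiantsHypothesis.ValiantsHypothesis.Theorems.PolyaContinuedMonotoneCoverHard

-- summit = sub-problem name (single-conjunct summit, D-0017 layout), so the namespace repeats it
set_option linter.dupNamespace false

open scoped Classical
open Finset

variable {R : Type*} [CommSemiring R] {ι : Type*}

/-- Abstract counting: if `C` is a function of `K` on `s` and `K` maps `s` into `t`, then `C` takes at
most `#t` values on `s`. -/
theorem card_image_le_of_factor {α β γ : Type*} [DecidableEq β] [DecidableEq γ] (s : Finset α)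
    (t : Finset β) (K : α → β) (C : α → γ)
    (hK : ∀ x ∈ s, K x ∈ t) (hKC : ∀ x ∈ s, ∀ y ∈ s, K x = K y → C x = C y) :
    (s.image C).card ≤ t.card := by
  set P := s.image fun x => (K x, C x) with hP
  have h1 : P.image Prod.snd = s.image C := by rw [hP, Finset.image_image]; rfl
  have h2 : P.image Prod.fst = s.image K := by rw [hP, Finset.image_image]; rfl
  have hinj : Set.InjOn Prod.fst (P : Set (β × γ)) := by
    rintro ⟨k₁, c₁⟩ hx ⟨k₂, c₂⟩ hy (hk : k₁ = k₂)
    simp only [hP, coe_image, Set.mem_image, mem_coe, Prod.mk.injEq] at hx hy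
    obtain ⟨x, hxs, rfl, rfl⟩ := hx
    obtain ⟨y, hys, rfl, rfl⟩ := hy
    exact Prod.ext hk (hKC x hxs y hys hk)
  calc (s.image C).card = (P.image Prod.snd).card := by rw [h1]
    _ ≤ P.card := card_image_le
    _ = (P.image Prod.fst).card := (card_image_of_injOn hinj).symm
    _ = (s.image K).card := by rw [h2]
    _ ≤ t.card := card_le_card (image_subset_iff.2 hK)

/-- LAYER CUT, inside count.  For a graded cover and a weight-nonzero perfect matching `τ`, the
variable edges of `τ` with both endpoints in the layer cut `S_h` are exactly its variable edges whose
row endpoint has level `< h`. -/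
theorem inside_filter_eq_of_graded {m : ℕ} (E : Finset (Fin m × Fin m))
    (a : Fin m × Fin m → MvPolynomial ι R) (g : Fin m ⊕ Fin m → ℕ) (h : ℕ)
    (hvar : ∀ i j, (i, j) ∈ E → (∃ k, a (i, j) = MvPolynomial.X k) →
      g (Sum.inr j) = g (Sum.inl i) + 1)
    (S : Finset (Fin m ⊕ Fin m)) (hSl : ∀ i, Sum.inl i ∈ S ↔ g (Sum.inl i) < h)
    (hSr : ∀ j, Sum.inr j ∈ S ↔ g (Sum.inr j) ≤ h)
    (τ : Equiv.Perm (Fin m)) (hτ : ∀ i, (i, τ i) ∈ E ∧ a (i, τ i) ≠ 0) :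
    (univ.filter fun i : Fin m =>
        Sum.inl i ∈ S ∧ Sum.inr (τ i) ∈ S ∧ ∃ j, a (i, τ i) = MvPolynomial.X j) =
      univ.filter fun i : Fin m => (∃ j, a (i, τ i) = MvPolynomial.X j) ∧ g (Sum.inl i) < h := by
  ext i
  simp only [mem_filter, mem_univ, true_and, hSl, hSr]
  constructor
  · rintro ⟨h1, -, h3⟩
    exact ⟨h3, h1⟩
  · rintro ⟨h3, h1⟩
    have := hvar i (τ i) (hτ i).1 h3
    exact ⟨h1, by omega, h3⟩

/-- LAYER CUT, inside count = `h`.  If every weight-nonzero perfect matching has exactly one variable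
edge with row endpoint on each level `ℓ < n`, then for `h ≤ n` it has exactly `h` variable edges with
row endpoint of level `< h`. -/
theorem card_var_below_eq_of_graded {m : ℕ} (n : ℕ)
    (a : Fin m × Fin m → MvPolynomial ι R) (g : Fin m ⊕ Fin m → ℕ) (h : ℕ) (hh : h ≤ n)
    (τ : Equiv.Perm (Fin m))
    (hlev : ∀ ℓ, ℓ < n → ∃! i : Fin m, (∃ k, a (i, τ i) = MvPolynomial.X k) ∧ g (Sum.inl i) = ℓ) :
    (univ.filter fun i : Fin m =>
        (∃ j, a (i, τ i) = MvPolynomial.X j) ∧ g (Sum.inl i) < h).card = h := by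
  have key : (univ.filter fun i : Fin m =>
      (∃ j, a (i, τ i) = MvPolynomial.X j) ∧ g (Sum.inl i) < h).card = (range h).card := by
    refine Finset.card_bij (fun i _ => g (Sum.inl i)) ?_ ?_ ?_
    · intro i hi
      simp only [mem_filter, mem_univ, true_and] at hi
      exact mem_range.2 hi.2
    · intro i hi i' hi' heq
      simp only [mem_filter, mem_univ, true_and] at hi hi'
      obtain ⟨i₀, -, huniq⟩ := hlev (g (Sum.inl i)) (by omega)
      exact (huniq i ⟨hi.1, rfl⟩).trans (huniq i' ⟨hi'.1, heq.symm⟩).symm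
    · intro ℓ hℓ
      have hℓ' : ℓ < h := mem_range.1 hℓ
      obtain ⟨i, ⟨hv, hg⟩, -⟩ := hlev ℓ (by omega)
      exact ⟨i, by simp [hv, hg, hℓ'], hg⟩
  rw [key, card_range]

/-- LAYER CUT, crossing set.  For a graded cover, the edges of a weight-nonzero perfect matching with
exactly one endpoint in `S_h` are its non-variable edges whose row endpoint has level `h`. -/
theorem crossing_filter_eq_of_graded {m : ℕ} (E : Finset (Fin m × Fin m))
    (a : Fin m × Fin m → MvPolynomial ι R) (g : Fin m ⊕ Fin m → ℕ) (h : ℕ)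
    (hvar : ∀ i j, (i, j) ∈ E → (∃ k, a (i, j) = MvPolynomial.X k) →
      g (Sum.inr j) = g (Sum.inl i) + 1)
    (hone : ∀ i j, (i, j) ∈ E → a (i, j) ≠ 0 → (¬ ∃ k, a (i, j) = MvPolynomial.X k) →
      g (Sum.inr j) = g (Sum.inl i))
    (S : Finset (Fin m ⊕ Fin m)) (hSl : ∀ i, Sum.inl i ∈ S ↔ g (Sum.inl i) < h)
    (hSr : ∀ j, Sum.inr j ∈ S ↔ g (Sum.inr j) ≤ h)
    (τ : Equiv.Perm (Fin m)) (hτ : ∀ i, (i, τ i) ∈ E ∧ a (i, τ i) ≠ 0) :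
    (univ.filter fun i : Fin m =>
        (Sum.inl i ∈ S ∧ Sum.inr (τ i) ∉ S) ∨ (Sum.inl i ∉ S ∧ Sum.inr (τ i) ∈ S)) =
      univ.filter fun i : Fin m => (¬ ∃ j, a (i, τ i) = MvPolynomial.X j) ∧ g (Sum.inl i) = h := by
  ext i
  simp only [mem_filter, mem_univ, true_and, hSl, hSr]
  by_cases hv : ∃ j, a (i, τ i) = MvPolynomial.X j
  · have := hvar i (τ i) (hτ i).1 hv
    constructor
    · intro h'; omega
    · rintro ⟨h', -⟩; exact absurd hv h'
  · have := hone i (τ i) (hτ i).1 (hτ i).2 hv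
    constructor
    · intro h'; exact ⟨hv, by omega⟩
    · rintro ⟨-, h'⟩; omega

/-- KEY LEMMA (entry/exit uniqueness).  In a graded cover in which weight-nonzero perfect matchings are
determined by their variable edges, the set of non-variable edges with row endpoint on level `h`
(`1 ≤ h`, `h < n`) of a weight-nonzero perfect matching `τ` is determined by the row endpoint of its
level-`h` variable edge together with the column endpoint of its level-`(h-1)` variable edge.  Proof:
if `τ, τ'` share that pair, the map that follows `τ'` on the other level-`h` rows and `τ` everywhere else
is again a weight-nonzero perfect matching with the same variable edges as `τ`, hence equals `τ`. -/
theorem crossing_eq_of_key_eq {m : ℕ} (n : ℕ) (E : Finset (Fin m × Fin m))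
    (a : Fin m × Fin m → MvPolynomial ι R) (g : Fin m ⊕ Fin m → ℕ) (h : ℕ) (h1 : 1 ≤ h) (hhn : h < n)
    (hvar : ∀ i j, (i, j) ∈ E → (∃ k, a (i, j) = MvPolynomial.X k) →
      g (Sum.inr j) = g (Sum.inl i) + 1)
    (hone : ∀ i j, (i, j) ∈ E → a (i, j) ≠ 0 → (¬ ∃ k, a (i, j) = MvPolynomial.X k) →
      g (Sum.inr j) = g (Sum.inl i))
    (hlev : ∀ τ : Equiv.Perm (Fin m), (∀ i, (i, τ i) ∈ E ∧ a (i, τ i) ≠ 0) →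
      ∀ ℓ, ℓ < n → ∃! i : Fin m, (∃ k, a (i, τ i) = MvPolynomial.X k) ∧ g (Sum.inl i) = ℓ)
    (hinj : ∀ τ τ' : Equiv.Perm (Fin m), (∀ i, (i, τ i) ∈ E ∧ a (i, τ i) ≠ 0) →
      (∀ i, (i, τ' i) ∈ E ∧ a (i, τ' i) ≠ 0) →
      (∀ i, ((∃ k, a (i, τ i) = MvPolynomial.X k) ∨ (∃ k, a (i, τ' i) = MvPolynomial.X k)) →
        τ i = τ' i) → τ = τ')
    (τ τ' : Equiv.Perm (Fin m)) (hτ : ∀ i, (i, τ i) ∈ E ∧ a (i, τ i) ≠ 0)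
    (hτ' : ∀ i, (i, τ' i) ∈ E ∧ a (i, τ' i) ≠ 0)
    (hK1 : (univ.filter fun i : Fin m => (∃ k, a (i, τ i) = MvPolynomial.X k) ∧ g (Sum.inl i) = h) =
      univ.filter fun i : Fin m => (∃ k, a (i, τ' i) = MvPolynomial.X k) ∧ g (Sum.inl i) = h)
    (hK2 : ((univ.filter fun i : Fin m =>
        (∃ k, a (i, τ i) = MvPolynomial.X k) ∧ g (Sum.inl i) = h - 1).image τ) =
      (univ.filter fun i : Fin m =>
        (∃ k, a (i, τ' i) = MvPolynomial.X k) ∧ g (Sum.inl i) = h - 1).image τ') :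
    ((univ.filter fun i : Fin m =>
        (¬ ∃ j, a (i, τ i) = MvPolynomial.X j) ∧ g (Sum.inl i) = h).image fun i => (i, τ i)) =
      (univ.filter fun i : Fin m =>
        (¬ ∃ j, a (i, τ' i) = MvPolynomial.X j) ∧ g (Sum.inl i) = h).image fun i => (i, τ' i) := by
  -- the level-`h` variable rows `r = r'` and the level-`(h-1)` exit columns `c = c'`
  obtain ⟨r, ⟨hrv, hrg⟩, hru⟩ := hlev τ hτ h hhn
  obtain ⟨r', ⟨hrv', hrg'⟩, hru'⟩ := hlev τ' hτ' h hhn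
  obtain ⟨q, ⟨hqv, hqg⟩, hqu⟩ := hlev τ hτ (h - 1) (by omega)
  obtain ⟨q', ⟨hqv', hqg'⟩, hqu'⟩ := hlev τ' hτ' (h - 1) (by omega)
  have hrr : r' = r := by
    have : r ∈ univ.filter fun i : Fin m =>
        (∃ k, a (i, τ' i) = MvPolynomial.X k) ∧ g (Sum.inl i) = h := by
      rw [← hK1]; simp [hrv, hrg]
    simp only [mem_filter, mem_univ, true_and] at this
    exact (hru' r this).symm ▸ rfl
  have hcc : τ' q' = τ q := by
    have : τ q ∈ (univ.filter fun i : Fin m =>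
        (∃ k, a (i, τ' i) = MvPolynomial.X k) ∧ g (Sum.inl i) = h - 1).image τ' := by
      rw [← hK2]; exact mem_image_of_mem _ (by simp [hqv, hqg])
    obtain ⟨i, hi, hiq⟩ := mem_image.1 this
    simp only [mem_filter, mem_univ, true_and] at hi
    rw [← hqu' i hi, hiq]
  set c := τ q with hc
  -- uniform facts about a weight-nonzero `σ` whose level-`h` variable row is `r` and whose
  -- level-`(h-1)` variable edge ends in `c`
  have hA : ∀ σ : Equiv.Perm (Fin m), (∀ i, (i, σ i) ∈ E ∧ a (i, σ i) ≠ 0) →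
      (∀ i, (∃ k, a (i, σ i) = MvPolynomial.X k) ∧ g (Sum.inl i) = h → i = r) →
      ∀ i, g (Sum.inl i) = h → i ≠ r →
        (¬ ∃ k, a (i, σ i) = MvPolynomial.X k) ∧ g (Sum.inr (σ i)) = h := by
    intro σ hσ hur i hi hir
    have hnv : ¬ ∃ k, a (i, σ i) = MvPolynomial.X k := fun hv => hir (hur i ⟨hv, hi⟩)
    exact ⟨hnv, (hone i (σ i) (hσ i).1 (hσ i).2 hnv).trans hi⟩
  have hB : ∀ σ : Equiv.Perm (Fin m), (∀ i, (i, σ i) ∈ E ∧ a (i, σ i) ≠ 0) →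
      (∃ k, a (r, σ r) = MvPolynomial.X k) →
      (∀ i, (∃ k, a (i, σ i) = MvPolynomial.X k) ∧ g (Sum.inl i) = h - 1 → σ i = c) →
      ∀ i, g (Sum.inr (σ i)) = h → σ i ≠ c → g (Sum.inl i) = h ∧ i ≠ r := by
    intro σ hσ hrσ huq i hi hic
    by_cases hv : ∃ k, a (i, σ i) = MvPolynomial.X k
    · have := hvar i (σ i) (hσ i).1 hv
      exact absurd (huq i ⟨hv, by omega⟩) hic
    · have := hone i (σ i) (hσ i).1 (hσ i).2 hv
      refine ⟨by omega, ?_⟩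
      rintro rfl
      exact hv hrσ
  have hCc : ∀ σ : Equiv.Perm (Fin m), ∀ qσ : Fin m, g (Sum.inl qσ) = h - 1 → σ qσ = c →
      ∀ i, g (Sum.inl i) = h → σ i ≠ c := by
    intro σ qσ hqσ hσq i hi hic
    have : i = qσ := σ.injective (hic.trans hσq.symm)
    rw [this] at hi
    omega
  -- specialisations
  have hurτ : ∀ i, (∃ k, a (i, τ i) = MvPolynomial.X k) ∧ g (Sum.inl i) = h → i = r :=
    fun i hi => hru i hi
  have hurτ' : ∀ i, (∃ k, a (i, τ' i) = MvPolynomial.X k) ∧ g (Sum.inl i) = h → i = r :=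
    fun i hi => (hru' i hi).trans hrr
  have huqτ : ∀ i, (∃ k, a (i, τ i) = MvPolynomial.X k) ∧ g (Sum.inl i) = h - 1 → τ i = c :=
    fun i hi => by rw [hqu i hi]
  have huqτ' : ∀ i, (∃ k, a (i, τ' i) = MvPolynomial.X k) ∧ g (Sum.inl i) = h - 1 → τ' i = c :=
    fun i hi => by rw [hqu' i hi, hcc]
  have hrvτ' : ∃ k, a (r, τ' r) = MvPolynomial.X k := hrr ▸ hrv'
  -- the recombined matching: `τ'` on the level-`h` rows other than `r`, `τ` elsewhere
  set A : Finset (Fin m) := univ.filter fun i : Fin m => g (Sum.inl i) = h ∧ i ≠ r with hAdef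
  have hmemA : ∀ i, i ∈ A ↔ g (Sum.inl i) = h ∧ i ≠ r := fun i => by simp [hAdef]
  set f : Fin m → Fin m := fun i => if i ∈ A then τ' i else τ i with hf
  have hfA : ∀ i, i ∈ A → f i = τ' i := fun i hi => if_pos hi
  have hfnA : ∀ i, i ∉ A → f i = τ i := fun i hi => if_neg hi
  have hfinj : Function.Injective f := by
    intro i i' hii'
    by_cases hi : i ∈ A <;> by_cases hi' : i' ∈ A
    · rw [hfA i hi, hfA i' hi'] at hii'
      exact τ'.injective hii'
    · exfalso
      rw [hfA i hi, hfnA i' hi'] at hii'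
      have hiA := (hmemA i).1 hi
      have h1 := (hA τ' hτ' hurτ' i hiA.1 hiA.2).2
      have h2 := hCc τ' q' hqg' (huqτ' q' ⟨hqv', hqg'⟩) i hiA.1
      rw [hii'] at h1 h2
      exact hi' ((hmemA i').2 (hB τ hτ hrv huqτ i' h1 h2))
    · exfalso
      rw [hfnA i hi, hfA i' hi'] at hii'
      have hiA' := (hmemA i').1 hi'
      have h1 := (hA τ' hτ' hurτ' i' hiA'.1 hiA'.2).2
      have h2 := hCc τ' q' hqg' (huqτ' q' ⟨hqv', hqg'⟩) i' hiA'.1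
      rw [← hii'] at h1 h2
      exact hi ((hmemA i).2 (hB τ hτ hrv huqτ i h1 h2))
    · rw [hfnA i hi, hfnA i' hi'] at hii'
      exact τ.injective hii'
  set σ : Equiv.Perm (Fin m) := Equiv.ofBijective f
    ⟨hfinj, Finite.surjective_of_injective hfinj⟩ with hσdef
  have hσf : ∀ i, σ i = f i := fun i => rfl
  have hσ : ∀ i, (i, σ i) ∈ E ∧ a (i, σ i) ≠ 0 := by
    intro i
    rw [hσf]
    by_cases hi : i ∈ A
    · rw [hfA i hi]; exact hτ' i
    · rw [hfnA i hi]; exact hτ i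
  have hτσ : τ = σ := by
    refine hinj τ σ hτ hσ fun i hi => ?_
    rw [hσf]
    by_cases hiA : i ∈ A
    · exfalso
      have hiA' := (hmemA i).1 hiA
      rcases hi with hi | hi
      · exact (hA τ hτ hurτ i hiA'.1 hiA'.2).1 hi
      · rw [hσf, hfA i hiA] at hi
        exact (hA τ' hτ' hurτ' i hiA'.1 hiA'.2).1 hi
    · exact (hfnA i hiA).symm
  have hagree : ∀ i, g (Sum.inl i) = h → i ≠ r → τ i = τ' i := by
    intro i hi hir
    have hiA : i ∈ A := (hmemA i).2 ⟨hi, hir⟩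
    have : τ i = σ i := by rw [hτσ]
    rw [this, hσf, hfA i hiA]
  -- both crossing filters are the level-`h` rows other than `r`
  have hfilt : ∀ σ' : Equiv.Perm (Fin m), (∀ i, (i, σ' i) ∈ E ∧ a (i, σ' i) ≠ 0) →
      (∀ i, (∃ k, a (i, σ' i) = MvPolynomial.X k) ∧ g (Sum.inl i) = h → i = r) →
      (∃ k, a (r, σ' r) = MvPolynomial.X k) →
      (univ.filter fun i : Fin m =>
          (¬ ∃ j, a (i, σ' i) = MvPolynomial.X j) ∧ g (Sum.inl i) = h) =
        univ.filter fun i : Fin m => g (Sum.inl i) = h ∧ i ≠ r := by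
    intro σ' hσ' hur hrσ'
    ext i
    simp only [mem_filter, mem_univ, true_and]
    constructor
    · rintro ⟨hnv, hi⟩
      exact ⟨hi, fun hir => hnv (hir ▸ hrσ')⟩
    · rintro ⟨hi, hir⟩
      exact ⟨(hA σ' hσ' hur i hi hir).1, hi⟩
  rw [hfilt τ hτ hurτ hrv, hfilt τ' hτ' hurτ' hrvτ']
  refine Finset.image_congr fun i hi => ?_
  simp only [coe_filter, mem_univ, true_and, Set.mem_setOf_eq] at hi
  simp [hagree i hi.1 hi.2]

end Summit.ValiantsHypothesis.ValiantsHypothesis.Theorems.PolyaContinuedMonotoneCoverHard
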